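import Literature.Geometry.Lorentzian.InverseMeanCurvatureFlowSemicontinuity
import HarnessLib

/-!
# Inverse mean curvature flow I — proofs: gradient bounds give local Lipschitz bounds

The Compactness Theorem 2.1 of Huisken–Ilmanen (J. Differential Geom. 59 (2001)), in the form of
`InverseMeanCurvatureFlowCompactness.lean` / `InverseMeanCurvatureFlowApproxCompactness.lean`,
asks for *local uniform Lipschitz bounds* (Riemannian distance) on the approximating solutions,
while elliptic theory delivers *gradient bounds* `|∇uᵢ| ≤ C` for the smooth solutions of the
regularisation ((3.6)/(3.9), Lemma 3.4). This file bridges the two: every point `p` has a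
neighbourhood `U` and a constant `c`, depending only on the chart at `p`, such that every function
differentiable on `U` with `|∇u| ≤ C` on `U` is `(C c)`-Lipschitz on `U` for the Riemannian distance
(`exists_nhds_forall_lipschitzOnWith_of_gradNorm_le`). In particular a family with a uniform
gradient bound near `p` is equi-Lipschitz near `p`, uniformly in the family — the hypothesis
`sup_K |∇uᵢ| ≤ C(K)` of Thm. 2.1 as read in this series of files.

Proof: in the chart `φ` at `p`, `|D(u ∘ φ⁻¹)(y) e| = |du(D(φ⁻¹) e)| ≤ |∇u| ‖D(φ⁻¹) e‖_h ≤ 2C ‖A e‖`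
near `p` (Cauchy–Schwarz `|du(ξ)| ≤ |∇u| ‖ξ‖`, and the norm comparison
`eventually_norm_symmL_le_and_norm_comp_le` of `VolumeChartFormula.lean`); the mean value
inequality on a ball of the chart (Mathlib's `Convex.lipschitzOnWith_of_nnnorm_fderiv_le`); and
the chart is Lipschitz from the length distance (`exists_nhds_riemannianEDist_le_and_edist_le`).

Everything is proved; there are no definitions and no named facts.

## References

* G. Huisken, T. Ilmanen, *The inverse mean curvature flow and the Riemannian Penrose
  inequality*, J. Differential Geom. 59 (2001) 353–437: Thm. 2.1 (hypothesis
  `sup_K |∇uᵢ| ≤ C(K)`), Lemma 3.4 ((3.7)–(3.9)).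
* D. Burago, Yu. Burago, S. Ivanov, *A course in metric geometry*, AMS 2001, §5.1.
-/

noncomputable section

open Bundle Set Manifold TopologicalSpace Filter Function Metric
open scoped ContDiff Topology ENNReal NNReal Manifold

namespace Literature.Geometry.Lorentzian

open PseudoRiemannianMetric

variable {X : Type*} [TopologicalSpace X] [ChartedSpace E3 X] [IsManifold (𝓡 3) ∞ X]
  (h : ContMDiffRiemannianMetric (𝓡 3) ∞ E3 (TangentSpace (𝓡 3) : X → Type _))

set_option backward.isDefEq.respectTransparency false in
/-- **Cauchy–Schwarz for the differential**: `|du_x(ξ)| ≤ |∇u|(x) ‖ξ‖_x`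
(`du(ξ) = ⟨♯du, ξ⟩`, `‖♯du‖ = |∇u|`). [folklore] -/
theorem abs_mvfderiv_le_gradNorm_mul_norm (u : X → ℝ) (x : X) (ξ : TangentSpace (𝓡 3) x) :
    letI : RiemannianBundle (fun x : X ↦ TangentSpace (𝓡 3) x) :=
      ⟨h.toContinuousRiemannianMetric.toRiemannianMetric⟩
    |mvfderiv (𝓡 3) u x ξ| ≤ gradNorm h u x * ‖ξ‖ := by
  letI : RiemannianBundle (fun x : X ↦ TangentSpace (𝓡 3) x) :=
    ⟨h.toContinuousRiemannianMetric.toRiemannianMetric⟩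
  set α : Module.Dual ℝ (TangentSpace (𝓡 3) x) := (mfderiv (𝓡 3) 𝓘(ℝ, ℝ) u x).toLinearMap
    with hα
  have h1 : mvfderiv (𝓡 3) u x ξ = h.inner x ((ofRiemannian h).sharp x α) ξ := by
    rw [← val_ofRiemannian, val_sharp_apply]; rfl
  have h2 : gradNorm h u x = ‖(ofRiemannian h).sharp x α‖ := by
    unfold gradNorm
    rw [← Real.sqrt_sq (norm_nonneg _), ← real_inner_self_eq_norm_sq]
    congr 1
    change α ((ofRiemannian h).sharp x α) = h.inner x _ _
    rw [← val_ofRiemannian, val_sharp_apply]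
  rw [h1, h2]
  exact abs_real_inner_le_norm ((ofRiemannian h).sharp x α) ξ

variable [T2Space X] [LocallyCompactSpace X]

set_option backward.isDefEq.respectTransparency false in
/-- **Gradient bounds give local Lipschitz bounds, uniformly in the function, on arbitrarily small
neighbourhoods.** Every neighbourhood `V₀` of `p` contains a neighbourhood `U` of `p` with a
constant `c` (depending only on the chart at `p`) such that: if `u` is differentiable at every point
of `U` with `|∇u| ≤ C` on `U`, then `u` is `(C c)`-Lipschitz on `U` for the Riemannian distance.
This turns the gradient estimates `|∇uᵢ| ≤ C(K)` of the regularised solutions (Huisken–Ilmanen 2001,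
Lemma 3.4, (3.9)) into the equi-Lipschitz hypothesis of the Compactness Theorem 2.1.
[cite: HuiskenIlmanenIMCF2001, Thm. 2.1 (hypotheses) and Lemma 3.4] -/
theorem exists_nhds_subset_forall_lipschitzOnWith_of_gradNorm_le (p : X) {V₀ : Set X}
    (hV₀ : V₀ ∈ 𝓝 p) :
    letI : RiemannianBundle (fun x : X ↦ TangentSpace (𝓡 3) x) :=
      ⟨h.toContinuousRiemannianMetric.toRiemannianMetric⟩
    letI : PseudoEMetricSpace X := .ofRiemannianMetric (𝓡 3) X
    ∃ U ∈ 𝓝 p, U ⊆ V₀ ∧ ∃ c : ℝ≥0, ∀ (u : X → ℝ) (C : ℝ≥0),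
      (∀ q ∈ U, MDifferentiableAt (𝓡 3) 𝓘(ℝ, ℝ) u q) → (∀ q ∈ U, gradNorm h u q ≤ C) →
        LipschitzOnWith (C * c) u U := by
  letI : RiemannianBundle (fun x : X ↦ TangentSpace (𝓡 3) x) :=
    ⟨h.toContinuousRiemannianMetric.toRiemannianMetric⟩
  letI : PseudoEMetricSpace X := .ofRiemannianMetric (𝓡 3) X
  classical
  set φ := extChartAt (𝓡 3) p with hφ
  set b : Module.Basis (Fin 3) ℝ E3 := (EuclideanSpace.basisFun (Fin 3) ℝ).toBasis with hb
  -- the linearization `A` of the chart at `p`, invertible as `Ae`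
  obtain ⟨A, hA⟩ := exists_norm_eq_norm_symmL (I := 𝓡 3) p p
  obtain ⟨Ae, hAe⟩ := exists_continuousLinearEquiv_of_norm_eq_norm_symmL (I := 𝓡 3) p p
    (mem_chart_source E3 p) hA
  -- (a) norm comparison `‖D(φ⁻¹)_q w‖ ≤ 2 ‖A w‖` near `p`
  have hcomp := eventually_norm_symmL_le_and_norm_comp_le (I := 𝓡 3) p p (mem_chart_source E3 p)
    hA one_lt_two
  -- (b) the chart is Lipschitz from the length distance near `p`
  obtain ⟨U₂, hU₂, hU₂src, -, hge⟩ :=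
    exists_nhds_riemannianEDist_le_and_edist_le (I := 𝓡 3) p p (mem_chart_source E3 p) hA
      one_lt_two
  -- the neighbourhood `V` where (a), (b) hold, and a chart ball inside it
  set V : Set X := {q | q ∈ (chartAt E3 p).source ∧
    (∀ w : E3, ‖(trivializationAt E3 (TangentSpace (𝓡 3)) p).symmL ℝ q w‖ ≤ (2 : ℝ≥0) * ‖A w‖) ∧
    (∀ v : TangentSpace (𝓡 3) q,
      ‖A ((trivializationAt E3 (TangentSpace (𝓡 3)) p).continuousLinearMapAt ℝ q v)‖ ≤
        (2 : ℝ≥0) * ‖v‖)} ∩ U₂ ∩ V₀ with hV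
  have hVn : V ∈ 𝓝 p := inter_mem (inter_mem hcomp hU₂) hV₀
  have hVsrc : V ⊆ φ.source := by
    rw [hφ, extChartAt_source]; exact fun q hq ↦ hq.1.1.1
  -- a ball `B = ball (φ p) r` in the target with `φ⁻¹(B) ⊆ V`
  have hTn : φ.target ∩ φ.symm ⁻¹' V ∈ 𝓝 (φ p) := by
    refine inter_mem ((isOpen_extChartAt_target p).mem_nhds (mem_extChartAt_target p)) ?_
    have hc : ContinuousAt φ.symm (φ p) := continuousAt_extChartAt_symm p
    refine hc.preimage_mem_nhds ?_
    rw [hφ, extChartAt_to_inv]; exact hVn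
  obtain ⟨r, hr, hball⟩ := Metric.mem_nhds_iff.1 hTn
  set U : Set X := φ.source ∩ φ ⁻¹' ball (φ p) r with hU
  have hUn : U ∈ 𝓝 p := by
    refine inter_mem (by rw [hφ]; exact extChartAt_source_mem_nhds p) ?_
    exact (continuousAt_extChartAt p).preimage_mem_nhds (ball_mem_nhds _ hr)
  have hUV : U ⊆ V := fun q hq ↦ by
    have := hball hq.2
    simpa only [mem_inter_iff, mem_preimage, φ.left_inv hq.1] using this.2
  have hUball : φ '' U ⊆ ball (φ p) r := by rintro _ ⟨q, hq, rfl⟩; exact hq.2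
  have hballU : ∀ z ∈ ball (φ p) r, φ.symm z ∈ U := fun z hz ↦ by
    have hzT : z ∈ φ.target := (hball hz).1
    exact ⟨φ.map_target hzT, by rw [mem_preimage, φ.right_inv hzT]; exact hz⟩
  -- the constant
  refine ⟨U, hUn, fun q hq ↦ (hUV hq).2, (2 * ‖A‖₊) * (‖(Ae.symm : E3 →L[ℝ] E3)‖₊ * 2), ?_⟩
  intro u C hdiff hgrad
  -- (1) `û = u ∘ φ⁻¹` is differentiable on the ball with `‖Dû‖ ≤ 2 C ‖A‖`
  set uh := u ∘ φ.symm with huh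
  have hmem : ∀ z ∈ ball (φ p) r, φ.symm z ∈ (chartAt E3 p).source := fun z hz ↦ by
    rw [← extChartAt_source (𝓡 3)]; exact (hballU z hz).1
  have hdiffE : ∀ z ∈ ball (φ p) r, DifferentiableAt ℝ uh z := by
    intro z hz
    have hzT : z ∈ φ.target := (hball hz).1
    have h1 := (mdifferentiableAt_iff_differentiableAt_chart (u := u) (hmem z hz)).1
      (hdiff _ (hballU z hz))
    rwa [show extChartAt (𝓡 3) p (φ.symm z) = z from φ.right_inv hzT] at h1
  have hbound : ∀ z ∈ ball (φ p) r, ‖fderiv ℝ uh z‖₊ ≤ C * (2 * ‖A‖₊) := by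
    intro z hz
    have hzT : z ∈ φ.target := (hball hz).1
    set q := φ.symm z with hq
    have hqs : q ∈ (chartAt E3 p).source := hmem z hz
    have hqV : q ∈ V := hUV (hballU z hz)
    have hφq : φ q = z := φ.right_inv hzT
    rw [← NNReal.coe_le_coe]
    push_cast
    refine ContinuousLinearMap.opNorm_le_bound _ (by positivity) fun e ↦ ?_
    -- `Dû(z) e = du_q (∑ eᵢ ∂ᵢ) = du_q (D(φ⁻¹) e)`
    have hrepr : e = ∑ i, (b.repr e i) • b i := (b.sum_repr e).symm
    have hframe : ∀ i, (trivializationAt E3 (TangentSpace (𝓡 3)) p).localFrame b i q =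
        (trivializationAt E3 (TangentSpace (𝓡 3)) p).symmL ℝ q (b i) := by
      intro i
      rw [localFrame_apply_eq_mfderivWithin_symm b hqs i, TangentBundle.symmL_trivializationAt hqs]
      rfl
    set ξ : TangentSpace (𝓡 3) q := (trivializationAt E3 (TangentSpace (𝓡 3)) p).symmL ℝ q e
      with hξ
    have hDe : fderiv ℝ uh z e = mvfderiv (𝓡 3) u q ξ := by
      have h1 : fderiv ℝ uh z e = ∑ i, b.repr e i * fderiv ℝ uh z (b i) := by
        conv_lhs => rw [hrepr]
        simp only [map_sum, map_smul, smul_eq_mul]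
      have h2 : ∀ i, fderiv ℝ uh z (b i) = mvfderiv (𝓡 3) u q
          ((trivializationAt E3 (TangentSpace (𝓡 3)) p).localFrame b i q) := by
        intro i
        rw [mvfderiv_apply_eq_mfderiv, mfderiv_apply_localFrame b hqs i, hφq]
      have h3 : ξ = ∑ i, (b.repr e i) • (trivializationAt E3 (TangentSpace (𝓡 3)) p).localFrame b i q := by
        rw [hξ]
        conv_lhs => rw [hrepr]
        simp only [map_sum, map_smul, hframe]
      rw [h1, h3, map_sum]
      refine Finset.sum_congr rfl fun i _ ↦ ?_
      rw [map_smul, smul_eq_mul, h2 i]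
    rw [hDe, Real.norm_eq_abs]
    calc |mvfderiv (𝓡 3) u q ξ| ≤ gradNorm h u q * ‖ξ‖ :=
          abs_mvfderiv_le_gradNorm_mul_norm h u q ξ
      _ ≤ C * ((2 : ℝ≥0) * ‖A e‖) :=
          mul_le_mul (hgrad q (hballU z hz)) (hqV.1.1.2.1 e) (norm_nonneg _) (NNReal.coe_nonneg C)
      _ ≤ C * ((2 : ℝ≥0) * (‖A‖ * ‖e‖)) := by gcongr; exact A.le_opNorm e
      _ = C * (2 * ‖A‖) * ‖e‖ := by push_cast; ring
  have hLipE : LipschitzOnWith (C * (2 * ‖A‖₊)) uh (ball (φ p) r) :=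
    (convex_ball _ _).lipschitzOnWith_of_nnnorm_fderiv_le hdiffE hbound
  -- (2) transfer to the manifold
  have hAq : ∀ z : E3, z = Ae.symm (A z) := fun z ↦ by
    rw [← hAe z, ContinuousLinearEquiv.symm_apply_apply]
  intro q hq q' hq'
  have hq1 : u q = uh (φ q) := by simp only [huh, Function.comp_apply, φ.left_inv hq.1]
  have hq'1 : u q' = uh (φ q') := by simp only [huh, Function.comp_apply, φ.left_inv hq'.1]
  have hqU₂ : q ∈ U₂ := (hUV hq).1.2
  have hq'U₂ : q' ∈ U₂ := (hUV hq').1.2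
  calc edist (u q) (u q') = edist (uh (φ q)) (uh (φ q')) := by rw [hq1, hq'1]
    _ ≤ (C * (2 * ‖A‖₊) : ℝ≥0) * edist (φ q) (φ q') := hLipE hq.2 hq'.2
    _ = (C * (2 * ‖A‖₊) : ℝ≥0) * edist (Ae.symm (A (φ q))) (Ae.symm (A (φ q'))) := by
        rw [← hAq, ← hAq]
    _ ≤ (C * (2 * ‖A‖₊) : ℝ≥0) * (‖(Ae.symm : E3 →L[ℝ] E3)‖₊ * edist (A (φ q)) (A (φ q'))) := by
        gcongr
        exact (Ae.symm : E3 →L[ℝ] E3).lipschitz.edist_le_mul _ _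
    _ ≤ (C * (2 * ‖A‖₊) : ℝ≥0) * (‖(Ae.symm : E3 →L[ℝ] E3)‖₊ * ((2 : ℝ≥0) * riemannianEDist (𝓡 3) q q')) := by
        gcongr
        exact hge q hqU₂ q' hq'U₂
    _ = ((C * ((2 * ‖A‖₊) * (‖(Ae.symm : E3 →L[ℝ] E3)‖₊ * 2)) : ℝ≥0) : ℝ≥0∞) * edist q q' := by
        rw [show edist q q' = riemannianEDist (𝓡 3) q q' from rfl]
        push_cast
        ring

/-- **Gradient bounds give local Lipschitz bounds, uniformly in the function.** Every point `p`
has a neighbourhood `U` and a constant `c` such that: if `u` is differentiable at every point of `U`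
with `|∇u| ≤ C` on `U`, then `u` is `(C c)`-Lipschitz on `U` for the Riemannian distance
(`exists_nhds_subset_forall_lipschitzOnWith_of_gradNorm_le` with `V₀ = X`).
[cite: HuiskenIlmanenIMCF2001, Thm. 2.1 (hypotheses) and Lemma 3.4] -/
theorem exists_nhds_forall_lipschitzOnWith_of_gradNorm_le (p : X) :
    letI : RiemannianBundle (fun x : X ↦ TangentSpace (𝓡 3) x) :=
      ⟨h.toContinuousRiemannianMetric.toRiemannianMetric⟩
    letI : PseudoEMetricSpace X := .ofRiemannianMetric (𝓡 3) X
    ∃ U ∈ 𝓝 p, ∃ c : ℝ≥0, ∀ (u : X → ℝ) (C : ℝ≥0),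
      (∀ q ∈ U, MDifferentiableAt (𝓡 3) 𝓘(ℝ, ℝ) u q) → (∀ q ∈ U, gradNorm h u q ≤ C) →
        LipschitzOnWith (C * c) u U := by
  obtain ⟨U, hU, -, c, hc⟩ := exists_nhds_subset_forall_lipschitzOnWith_of_gradNorm_le h p univ_mem
  exact ⟨U, hU, c, hc⟩

end Literature.Geometry.Lorentzian

end
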